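import Summits.NavierStokesRegularity.NavierStokesRegularity.Theses.HubbleDynamo
import HarnessLib

/-!
# Route HubbleDynamo — crux `FarFieldSlaving` (stmt-NavierStokesRegularity-1935): the isolation
  stub is NECESSARY for the crux

Support file (theorems only, `--supports stmt-NavierStokesRegularity-1935`).

The registered skeleton of the crux (line `registered`, `Cruxes/FarFieldSlaving/Lines/registered.lean`)
cuts `FarFieldSlaving` into four stubs, of which `stub_isolatedSingularPoints` (A) says: under
the crux hypotheses every point `x₀` has a punctured neighbourhood of points that are regular up
to time `T` (the velocity is bounded on a small parabolic cylinder below `(x, T)` for every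
`x ≠ x₀` near `x₀`). This file proves that A is IMPLIED BY the crux
(`hubbleDynamo_isolatedSingularPoints_of_farFieldSlaving`): the space–time Type-I bound at `x₀`,
`‖u t y‖ ≤ C / (‖y − x₀‖ + √(T − t))` on `B_δ(x₀) × (T − δ², T)`, bounds `u` by `2|C|/‖x − x₀‖` on
the cylinder `B_{d/2}(x) × (T − (d/2)², T)`, `d = ‖x − x₀‖`, for every `x` with
`0 < ‖x − x₀‖ < δ/2`. So the cut at A is honest in the strong sense: A is sandwiched between the
crux and (with the other three stubs) the crux, and promoting A to an item of its own ("Type I in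
time ⇒ the time-`T` singular set is discrete") loses nothing of the crux. Elementary; no
literature input.
-/

noncomputable section

-- the problem directory repeats the summit name (D-0017); core's `dupNamespace` linter fires on
-- every declaration of `Summit.NavierStokesRegularity.NavierStokesRegularity.…`
set_option linter.dupNamespace false

namespace Summit.NavierStokesRegularity.NavierStokesRegularity.Theorems

open Set Filter Topology Function MeasureTheory Metric
open Literature.Analysis Literature.Analysis.FluidPDE
open Summit.NavierStokesRegularity.NavierStokesRegularity.Theses

/-- **The crux `FarFieldSlaving` implies its isolation stub** (`stub_isolatedSingularPoints` of
line `registered`, verbatim as registered on stmt-NavierStokesRegularity-1935): a space–time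
Type-I bound at `x₀` on `B_δ(x₀) × (T − δ², T)` makes every `x` with `0 < ‖x − x₀‖ < δ/2`
regular up to time `T`, with the bound `2|C| / ‖x − x₀‖` on `B_{d/2}(x) × (T − (d/2)², T)`,
`d = ‖x − x₀‖` (there `‖y − x₀‖ ≥ d/2` and `√(T − t) ≥ 0`). [folklore] -/
theorem hubbleDynamo_isolatedSingularPoints_of_farFieldSlaving :
    Summit.NavierStokesRegularity.NavierStokesRegularity.Theses.HubbleDynamo.FarFieldSlaving →
      ∀ (ν T : ℝ), 0 < ν → 0 < T →
      ∀ (u : ℝ → EuclideanSpace ℝ (Fin 3) → EuclideanSpace ℝ (Fin 3))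
        (p : ℝ → EuclideanSpace ℝ (Fin 3) → ℝ),
        Literature.Analysis.FluidPDE.IsClassicalNSSolutionOn (Set.Ico 0 T) ν 0 u p →
        Literature.Analysis.FluidPDE.IsLerayHopfOn T ν 0 (u 0) u →
        Literature.Analysis.FluidPDE.HasRapidSpatialDecay (u 0) →
        Literature.Analysis.FluidPDE.IsTypeIBlowup u T →
        ∀ x₀ : EuclideanSpace ℝ (Fin 3), ∃ ρ : ℝ, 0 < ρ ∧
          ∀ x ∈ Metric.ball x₀ ρ, x ≠ x₀ →
            ∃ r : ℝ, 0 < r ∧ ∃ M : ℝ, ∀ t ∈ Set.Ioo (T - r ^ 2) T, ∀ y ∈ Metric.ball x r,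
              ‖u t y‖ ≤ M := by
  intro hX ν T hν hT u p hcl hLH hdec hTI x₀
  obtain ⟨δ, hδ, C, hC⟩ := hX ν T hν hT u p hcl hLH hdec hTI x₀
  refine ⟨δ / 2, by positivity, fun x hx hne => ?_⟩
  -- `d = ‖x - x₀‖ ∈ (0, δ/2)`
  set d : ℝ := ‖x - x₀‖ with hd_def
  have hdpos : 0 < d := norm_pos_iff.2 (sub_ne_zero.2 hne)
  have hdlt : d < δ / 2 := by rwa [hd_def, ← dist_eq_norm, ← Metric.mem_ball]
  refine ⟨d / 2, by positivity, 2 * |C| / d, fun t ht y hy => ?_⟩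
  -- the cylinder `B_{d/2}(x) × (T − (d/2)², T)` sits inside `B_δ(x₀) × (T − δ², T)`
  have hyx : ‖y - x‖ < d / 2 := by rwa [← dist_eq_norm, ← Metric.mem_ball]
  have hy_upper : ‖y - x₀‖ < δ := by
    calc ‖y - x₀‖ = ‖(y - x) + (x - x₀)‖ := by rw [sub_add_sub_cancel]
      _ ≤ ‖y - x‖ + ‖x - x₀‖ := norm_add_le _ _
      _ < d / 2 + d := by linarith
      _ < δ := by linarith
  have hy_lower : d / 2 ≤ ‖y - x₀‖ := by
    have h1 : ‖x - x₀‖ ≤ ‖x - y‖ + ‖y - x₀‖ := by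
      calc ‖x - x₀‖ = ‖(x - y) + (y - x₀)‖ := by rw [sub_add_sub_cancel]
        _ ≤ ‖x - y‖ + ‖y - x₀‖ := norm_add_le _ _
    have h2 : ‖x - y‖ = ‖y - x‖ := norm_sub_rev _ _
    linarith
  have hyball : y ∈ Metric.ball x₀ δ := by rwa [Metric.mem_ball, dist_eq_norm]
  have hsq : (d / 2) ^ 2 < δ ^ 2 := by nlinarith
  have ht' : t ∈ Set.Ioo (T - δ ^ 2) T := ⟨by linarith [ht.1], ht.2⟩
  -- the crux bound at `(t, y)` and the comparison of denominators
  have hden : d / 2 ≤ ‖y - x₀‖ + Real.sqrt (T - t) :=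
    hy_lower.trans (le_add_of_nonneg_right (Real.sqrt_nonneg _))
  have hdenpos : 0 < ‖y - x₀‖ + Real.sqrt (T - t) := lt_of_lt_of_le (by positivity) hden
  calc ‖u t y‖ ≤ C / (‖y - x₀‖ + Real.sqrt (T - t)) := hC t ht' y hyball
    _ ≤ |C| / (‖y - x₀‖ + Real.sqrt (T - t)) :=
        div_le_div_of_nonneg_right (le_abs_self C) hdenpos.le
    _ ≤ |C| / (d / 2) := div_le_div_of_nonneg_left (abs_nonneg C) (by positivity) hden
    _ = 2 * |C| / d := by field_simp

end Summit.NavierStokesRegularity.NavierStokesRegularity.Theorems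

end
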